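import Mathlib
import HarnessLib
import Summits.ValiantsHypothesis.ValiantsHypothesis.Theses.MonotoneRestoration
import Literature.Computability.AlgebraicComplexity.ArithCircuit
import Literature.Computability.AlgebraicComplexity.ArithCircuitProofs
import Literature.Computability.AlgebraicComplexity.MonotoneStructure
import Literature.Computability.AlgebraicComplexity.PermanentIrreducible
import Literature.ModelTheory.FiniteModelTheory.CkEquiv
import Summits.ValiantsHypothesis.ValiantsHypothesis.Theorems.MonotoneRestorationMonotoneRestorationQPCosetCount
import Summits.ValiantsHypothesis.ValiantsHypothesis.Theorems.MonotoneRestorationMonotoneRestorationQPSymmetricLB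
import Summits.ValiantsHypothesis.ValiantsHypothesis.Theorems.MonotoneRestorationMonotoneRestorationQPSupportSymmetrisation
import Summits.ValiantsHypothesis.ValiantsHypothesis.Theorems.MonotoneRestorationMonotoneRestorationQPSparseRegime
import Summits.ValiantsHypothesis.ValiantsHypothesis.Theorems.MonotoneRestorationMonotoneRestorationQPBeta
import Literature.Computability.AlgebraicComplexity.SymmetricArithCircuit
import Literature.Computability.AlgebraicComplexity.DawarWilsenach2025Proofs
import Literature.GroupTheory.PermutationGroups.SmallIndexSubgroups
import Summits.ValiantsHypothesis.ValiantsHypothesis.Theorems.MonotoneRestorationQP.Negative.LoadBearing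
import Summits.ValiantsHypothesis.ValiantsHypothesis.Theorems.MonotoneRestorationMonotoneRestorationQPPermSupportCount

/-! TTRL-lite variant V19904 of stmt-ValiantsHypothesis-15886 -/

-- `ValiantsHypothesis.ValiantsHypothesis`: the D-0017 layout repeats the problem name in the path.
set_option linter.dupNamespace false

namespace Summit.ValiantsHypothesis.ValiantsHypothesis.Theorems

open Summit.ValiantsHypothesis.ValiantsHypothesis.Theses.MonotoneRestoration
open Literature.Computability.AlgebraicComplexity

/-- **Shift-embedding into a homogeneous polynomial pins the degree** (TTRL-lite variant V19904
of `stub_mulGate_children_extend`; the sharpened degree bookkeeping of the γ-dropping step on the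
multiplication-gate spine). If `f` is homogeneous of degree `d`, `p ≠ 0`, and every monomial `m`
of `p` extends by a common shift `μ` to a monomial `m + μ` of `f`, then every such `m` has
`deg m + deg μ = deg (m + μ) = d`; hence `p` is homogeneous of degree `d - deg μ`, and since
`p ≠ 0` has at least one monomial, `deg μ ≤ d` and `totalDegree p + deg μ = d`. [folklore] -/
theorem stub_mulGate_children_extend_var19904 :
    ∀ (n d : ℕ) (p f : MvPolynomial (Fin n × Fin n) NNReal) (μ : (Fin n × Fin n) →₀ ℕ),
      f.IsHomogeneous d → p ≠ 0 → (∀ m ∈ p.support, m + μ ∈ f.support) →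
      p.IsHomogeneous (d - μ.degree) ∧ p.totalDegree + μ.degree = d := by
  intro n d p f μ hf hp hext
  -- every monomial of `p` has degree `d - deg μ` (and `deg μ ≤ d`)
  have hkey : ∀ m ∈ p.support, m.degree + μ.degree = d := by
    intro m hm
    have hmf := hext m hm
    rw [MvPolynomial.mem_support_iff] at hmf
    by_contra hne
    apply hmf
    apply hf.coeff_eq_zero
    rw [map_add]
    exact hne
  -- hence `p`, a sum of its monomials, is homogeneous of degree `d - deg μ`
  have hhom : p.IsHomogeneous (d - μ.degree) := by
    rw [p.as_sum]
    apply MvPolynomial.IsHomogeneous.sum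
    intro m hm
    apply MvPolynomial.isHomogeneous_monomial
    have := hkey m hm
    omega
  refine ⟨hhom, ?_⟩
  -- `p ≠ 0` has a monomial, which witnesses `deg μ ≤ d`
  obtain ⟨m, hm⟩ := MvPolynomial.exists_coeff_ne_zero hp
  have := hkey m (MvPolynomial.mem_support_iff.mpr hm)
  rw [hhom.totalDegree hp]
  omega

end Summit.ValiantsHypothesis.ValiantsHypothesis.Theorems
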